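import Mathlib.Analysis.Calculus.MeanValue
import Mathlib.Topology.MetricSpace.Basic

/-!
# Mean-value reduction to the leg form from right derivatives

Helper file for the crux `QuadrupoleSelectionRule` (stmt-CriticalPhenomena-7029), route
`CardyFlipRusso`, sub-problem `CardyFormulaZ2`, line `Sketch` generation 3, stub G3:
uniform closeness along a leg from a `σ`-uniform bound on RIGHT derivatives and continuity.
This is the form in which the Poisson superposition leg's one-sided Margulis–Russo formula is
consumed (that leg only supplies right derivatives `HasDerivWithinAt _ _ (Ici σ) σ`).

Let `P σ δ` be a family of (crossing) probabilities along a leg `σ ∈ [0, σ₀]` at mesh `δ`, continuous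
in `σ` on `[0, σ₀]` and with a right derivative `D σ δ` in `σ` at every point of `[0, σ₀)`, for every
mesh `0 < δ < 1`.  If `|D σ δ| ≤ η δ` uniformly in `σ ∈ [0, σ₀)` and `η δ → 0` as `δ → 0⁺`, then the
probabilities are uniformly close along the leg for small mesh: for every `ε > 0` there is
`δ₀ > 0` such that `|P σ δ − P σ' δ| ≤ ε` for all `0 < δ < δ₀` and all `σ, σ' ∈ [0, σ₀]`.

The proof is Mathlib's one-sided mean value inequality
`norm_image_sub_le_of_norm_deriv_right_le_segment` on the sub-segment `[σ, σ'] ⊆ [0, σ₀]`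
(after ordering `σ ≤ σ'`): `|P σ' δ − P σ δ| ≤ η δ · (σ' − σ) ≤ η δ · σ₀`, and `η δ < ε / σ₀` for
`δ` small (metric `ε`–`δ` characterisation of `Tendsto` at `𝓝[>] 0`).  This is the right-derivative
twin of `uniform_close_of_deriv_bound` in
`Summits/CriticalPhenomena/CardyFormulaZ2/Theorems/CardyFlipRussoQuadrupoleSelectionRuleLegMVT.lean`.
-/

noncomputable section

open Filter Topology Set

namespace Summit.CriticalPhenomena.CardyFormulaZ2.Theorems

/-- One-sided mean value inequality along the leg `[0, σ₀]`, ordered form: if `P` is continuous on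
`[0, σ₀]`, has right derivative `D σ` at every `σ ∈ [0, σ₀)` and `|D σ| ≤ C` there, then
`|P σ' − P σ| ≤ C · (σ' − σ)` for all `0 ≤ σ ≤ σ' ≤ σ₀`. [folklore] -/
theorem abs_sub_le_mul_sub_of_hasDerivWithinAt_Ici (P D : ℝ → ℝ) (σ₀ C : ℝ)
    (hcont : ContinuousOn P (Icc (0 : ℝ) σ₀))
    (hderiv : ∀ σ ∈ Ico (0 : ℝ) σ₀, HasDerivWithinAt P (D σ) (Ici σ) σ)
    (hbound : ∀ σ ∈ Ico (0 : ℝ) σ₀, |D σ| ≤ C) (σ σ' : ℝ) (hσ : 0 ≤ σ) (hσσ' : σ ≤ σ')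
    (hσ' : σ' ≤ σ₀) : |P σ' - P σ| ≤ C * (σ' - σ) := by
  -- restrict everything to the sub-segment `[σ, σ'] ⊆ [0, σ₀]`
  have hsub : ∀ x ∈ Ico σ σ', x ∈ Ico (0 : ℝ) σ₀ := fun x hx =>
    ⟨hσ.trans hx.1, lt_of_lt_of_le hx.2 hσ'⟩
  have hmvt := norm_image_sub_le_of_norm_deriv_right_le_segment (f := P) (f' := D) (a := σ)
    (b := σ') (C := C) (hcont.mono (Icc_subset_Icc hσ hσ'))
    (fun x hx => hderiv x (hsub x hx))
    (fun x hx => (Real.norm_eq_abs _).trans_le (hbound x (hsub x hx))) σ'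
    (right_mem_Icc.2 hσσ')
  rwa [Real.norm_eq_abs] at hmvt

/-- One-sided mean value inequality along the leg `[0, σ₀]`: if `P` is continuous on `[0, σ₀]`,
has right derivative `D σ` at every `σ ∈ [0, σ₀)` and `|D σ| ≤ C` there (with `0 < σ₀`), then
`|P σ − P σ'| ≤ C · σ₀` for all `σ, σ' ∈ [0, σ₀]`. [folklore] -/
theorem abs_sub_le_mul_of_hasDerivWithinAt_Ici (P D : ℝ → ℝ) (σ₀ C : ℝ) (hσ₀ : 0 < σ₀)
    (hcont : ContinuousOn P (Icc (0 : ℝ) σ₀))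
    (hderiv : ∀ σ ∈ Ico (0 : ℝ) σ₀, HasDerivWithinAt P (D σ) (Ici σ) σ)
    (hbound : ∀ σ ∈ Ico (0 : ℝ) σ₀, |D σ| ≤ C) (σ : ℝ) (hσ : σ ∈ Icc (0 : ℝ) σ₀) (σ' : ℝ)
    (hσ' : σ' ∈ Icc (0 : ℝ) σ₀) : |P σ - P σ'| ≤ C * σ₀ := by
  -- `C ≥ 0` since it bounds an absolute value at `0 ∈ [0, σ₀)`
  have hC : 0 ≤ C := le_trans (abs_nonneg _) (hbound 0 ⟨le_rfl, hσ₀⟩)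
  rcases le_total σ σ' with h | h
  · -- `σ ≤ σ'`
    rw [abs_sub_comm]
    calc |P σ' - P σ| ≤ C * (σ' - σ) :=
          abs_sub_le_mul_sub_of_hasDerivWithinAt_Ici P D σ₀ C hcont hderiv hbound σ σ' hσ.1 h hσ'.2
      _ ≤ C * σ₀ := mul_le_mul_of_nonneg_left (by linarith [hσ.1, hσ'.2]) hC
  · -- `σ' ≤ σ`
    calc |P σ - P σ'| ≤ C * (σ - σ') :=
          abs_sub_le_mul_sub_of_hasDerivWithinAt_Ici P D σ₀ C hcont hderiv hbound σ' σ hσ'.1 h hσ.2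
      _ ≤ C * σ₀ := mul_le_mul_of_nonneg_left (by linarith [hσ'.1, hσ.2]) hC

/-- **Mean-value reduction to the leg form from right derivatives** (stub G3 of line `Sketch`,
generation 3, for the crux `QuadrupoleSelectionRule`).  For meshes `0 < δ < 1` let `σ ↦ P σ δ` be
continuous on the leg `[0, σ₀]` with right derivative `D σ δ` at every `σ ∈ [0, σ₀)`.  A `σ`-uniform
bound `|D σ δ| ≤ η δ` with `η δ → 0` as `δ → 0⁺` gives uniform closeness of `P · δ` along the leg for
small mesh: for every `ε > 0` there is `δ₀ > 0` with `|P σ δ − P σ' δ| ≤ ε` for all `0 < δ < δ₀`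
and `σ, σ' ∈ [0, σ₀]`. [folklore] -/
theorem uniform_close_of_deriv_right_bound (P D : ℝ → ℝ → ℝ) (η : ℝ → ℝ) (σ₀ : ℝ) (hσ₀ : 0 < σ₀)
    (hcont : ∀ δ, 0 < δ → δ < 1 → ContinuousOn (fun s => P s δ) (Icc (0 : ℝ) σ₀))
    (hderiv : ∀ δ, 0 < δ → δ < 1 → ∀ σ ∈ Ico (0 : ℝ) σ₀,
      HasDerivWithinAt (fun s => P s δ) (D σ δ) (Ici σ) σ)
    (hbound : ∀ δ, 0 < δ → δ < 1 → ∀ σ ∈ Ico (0 : ℝ) σ₀, |D σ δ| ≤ η δ)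
    (hη : Tendsto η (𝓝[>] 0) (𝓝 0)) :
    ∀ ε : ℝ, 0 < ε → ∃ δ₀ : ℝ, 0 < δ₀ ∧ ∀ δ : ℝ, 0 < δ → δ < δ₀ →
      ∀ σ ∈ Icc (0 : ℝ) σ₀, ∀ σ' ∈ Icc (0 : ℝ) σ₀, |P σ δ - P σ' δ| ≤ ε := by
  intro ε hε
  -- `η δ → 0` as `δ → 0⁺`: pick `d > 0` with `|η δ| < ε / σ₀` for `0 < δ < d`
  rw [Metric.tendsto_nhdsWithin_nhds] at hη
  obtain ⟨d, hd, hηd⟩ := hη (ε / σ₀) (div_pos hε hσ₀)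
  refine ⟨min d 1, lt_min hd one_pos, fun δ hδ hδlt σ hσ σ' hσ' => ?_⟩
  have hδd : δ < d := lt_of_lt_of_le hδlt (min_le_left _ _)
  have hδ1 : δ < 1 := lt_of_lt_of_le hδlt (min_le_right _ _)
  have hηδ : |η δ| < ε / σ₀ := by
    have h := hηd (show δ ∈ Ioi (0 : ℝ) from hδ) (by rwa [Real.dist_0_eq_abs, abs_of_pos hδ])
    rwa [Real.dist_0_eq_abs] at h
  -- one-sided mean value inequality along the leg at mesh `δ`, then `η δ · σ₀ ≤ (ε / σ₀) · σ₀ = ε`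
  have hmvt : |P σ δ - P σ' δ| ≤ η δ * σ₀ :=
    abs_sub_le_mul_of_hasDerivWithinAt_Ici (fun s => P s δ) (fun s => D s δ) σ₀ (η δ) hσ₀
      (hcont δ hδ hδ1) (hderiv δ hδ hδ1) (hbound δ hδ hδ1) σ hσ σ' hσ'
  calc |P σ δ - P σ' δ| ≤ η δ * σ₀ := hmvt
    _ ≤ ε / σ₀ * σ₀ := mul_le_mul_of_nonneg_right ((le_abs_self _).trans hηδ.le) hσ₀.le
    _ = ε := div_mul_cancel₀ ε hσ₀.ne'

end Summit.CriticalPhenomena.CardyFormulaZ2.Theorems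

end
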